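import Mathlib
import HarnessLib
import Summits.HubbardSuperconductivity.HubbardSuperconductivity.Theorems.KLProgrammeKLRegimeEngineFrameShiftMomentDoorFlowPosition
import Summits.HubbardSuperconductivity.HubbardSuperconductivity.Theorems.KLProgrammeKLRegimeEngineFrameShiftPieceTables
import Summits.HubbardSuperconductivity.HubbardSuperconductivity.Theorems.KLProgrammeKLRegimeEngineFlowPieceTablesGeometric

/-!
# K3 gen-8-FLOW (stmt 20437 `KLRegimeEngineV17F2`, stub (C)): DOOR (B) ON THE FLOW FRAMES KEYED TO THE HISTORY — kernel inputs in position currency,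
# piece tables from `(I-F jets)` + reading jets, the fit and the table DISCHARGED with explicit `d`, `J`

Cell gate-hubbard-kl, seat p2 g12.  Composition of this seat's three bricks on top of door (B) (p545976 / p547378):
`…EngineFrameShiftMomentDoorFlowPosition` (kernel inputs `Nₚ`, `Sₚ` = pinned weighted position norms, via the leg-pair Fourier bridge p549586),
`…EngineFlowPieceTablesGeometric` (the geometric piece table `A_j·4^{(j−2)m}`, `j ≤ 6`, from `FlowPieceJetsAt` and `TwoLegReadJetsF` of the scales `m ≤ n`)
and `…EngineFrameShiftPieceTables` (the arithmetic: `hfit` with `d = 4 + 2ΣA`, `hJ` with the explicit `J`).  What is LEFT as hypotheses is exactly the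
registrant's list: `Z_t ≠ 0` and the tower's pinned norms `Nₚ`, `Sₚ` along the interpolation `C^{K_n}_{>Λ} + t(C^{K_{n+1}}_{>Λ} − C^{K_n}_{>Λ})`, one cutoff jet
table `B` (orders `≤ N'`, `N' ≥ r + 4`), the history rows `∀ m ≤ n, FlowPieceJetsAt … R m` / `∀ m ≤ n, TwoLegReadJetsF … m` (inside
`HistP klPredsV17F2 … (n+1)` by `histV17F2_of_histP`), and the scale window `4^n ≤ 6/m_ω ≤ X₁·4^n` of the reading frequency (`m_ω = max(|ω_i|, Λ/2)`;
at `Λ = Λ_n = 4^{−n}/32`, `ω_i = ±π/β`, `n ≤ n_β + 1`: `X₁ = 384`).  The constants `A`, `d`, `J` enter through DEFINING EQUATIONS (instantiate with `rfl`).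

* **`moment_selfEnergy_flowStep_sub_le_of_hist`** — the order-`r` (`r ≤ 4`) position moments of the two-leg frame response between `K_n` and `K_{n+1}`;
* **`norm_iteratedFDeriv_evalM_symInterp_flowStep_response_le_of_hist`** — its reading (momentum jets of the interpolated spin/frequency average).

Proofs only; no definitions; nothing about the sizes of `Nₚ`, `Sₚ` is asserted; nothing asserts superconductivity.
References: Salmhofer 1998 §3.1; BGM 2006 §2.3 (2.17), §3 (3.2)–(3.8) [cite: BenfattoGiulianiMastropietro2006].
-/

noncomputable section

namespace Summit.HubbardSuperconductivity.HubbardSuperconductivity.Theorems.EngineV8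

set_option linter.dupNamespace false -- summit = problem name (single-conjunct summit), D-0017

open Finset Literature.MathematicalPhysics.QuantumLattice Literature.Probability.LatticeModels GrassmannAlgebra Set
open Summit.HubbardSuperconductivity.HubbardSuperconductivity.Theorems.KLRegimeSplit
open scoped Nat

variable {L M : ℕ} [NeZero L] [NeZero M]

omit [NeZero L] [NeZero M] in
/-- One cutoff jet table serves all three cutoff inputs: `|χ′| ≤ B` from the order-`1` row. -/
theorem abs_deriv_salmhoferCutoff_le_of_table {N' : ℕ} {B : ℝ} (hB : ∀ l ≤ N', ∀ t, ‖iteratedDeriv l salmhoferCutoff t‖ ≤ B) (hN' : 1 ≤ N')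
    (y : ℝ) : |deriv salmhoferCutoff y| ≤ B := by
  have h := hB 1 hN' y
  rwa [iteratedDeriv_one, Real.norm_eq_abs] at h

omit [NeZero L] [NeZero M] in
/-- … and the `iteratedFDeriv` rows of order `≤ 4` from the rows `≤ N'`, `N' ≥ 4`. -/
theorem norm_iteratedFDeriv_salmhoferCutoff_le_of_table {N' : ℕ} {B : ℝ} (hB : ∀ l ≤ N', ∀ t, ‖iteratedDeriv l salmhoferCutoff t‖ ≤ B)
    (hN' : 4 ≤ N') : ∀ l ≤ 4, ∀ x : ℝ, ‖iteratedFDeriv ℝ l salmhoferCutoff x‖ ≤ B := fun l hl x => by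
  rw [norm_iteratedFDeriv_eq_norm_iteratedDeriv]
  exact hB l (hl.trans hN') x

/-- **DOOR (B) ON THE FLOW FRAMES, KEYED TO THE HISTORY**: for `r ≤ 4`, the order-`r` position moments of the frame-shift response of the two-leg kernel
between `K_n` and `K_{n+1}` at the reading frequency `ω_i`, with: kernel inputs `Nₚ`, `Sₚ` in position currency; piece tables from `FlowPieceJetsAt` /
`TwoLegReadJetsF` of the scales `m ≤ n`; `hfit`/`hJ` discharged (`d`, `J` by defining equations); one cutoff table `B`; the scale window of `ω_i`. -/
theorem moment_selfEnergy_flowStep_sub_le_of_hist {β : ℝ} (hβ : 0 < β) {Λ : ℝ} (hΛ : 0 < Λ) {μ : ℝ} (hμ : μ ∈ klWindowC) (U : ℝ) (n : ℕ)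
    {s₀ s₁ : FreqMomentum L M × Fin 2 → ℂ} (hs₀ : s₀ = uvSymbolCT L M β μ (klFlowFrameU L M β U μ n) Λ)
    (hs₁ : s₁ = uvSymbolCT L M β μ (klFlowFrameU L M β U μ (n + 1)) Λ) (i : MatsubaraIdx M) (σ : Fin 2) {r : ℕ} (hr : r ≤ 4)
    (hZ : ∀ t ∈ Set.Icc (0 : ℝ) 1, effPartitionFn ℂ (normalCovariance L M s₀ + ((t : ℂ)) • (normalCovariance L M s₁ - normalCovariance L M s₀))
      (hubbardInteraction L M β U) ≠ 0)
    {Np Sp : ℝ}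
    (hNp : ∀ t ∈ Set.Icc (0 : ℝ) 1, ∀ (τ c : Fin 2) (x₀ : SpaceTimeIdx L M), imagTimeWeight β M ^ 3 *
      ∑ x ∈ (univ : Finset (Fin 4 → SpaceTimeIdx L M)).filter (fun x => x 0 = x₀),
        (1 + ((((x 1).2 - (x 0).2) 0).valMinAbs.natAbs : ℝ) + ((((x 1).2 - (x 0).2) 1).valMinAbs.natAbs : ℝ)) ^ r *
          ‖sectorisedKernel L M β (trivialMultiplier L M)
              (effAction ℂ (normalCovariance L M s₀ + ((t : ℂ)) • (normalCovariance L M s₁ - normalCovariance L M s₀))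
                (hubbardInteraction L M β U)) 4
              (![((0, σ), 0), ((0, σ), 1), ((0, τ), 1 - c), ((0, τ), c)] : Fin 4 → SectorLeg 1) x‖ ≤ Np)
    (hSp : ∀ t ∈ Set.Icc (0 : ℝ) 1, ∀ x₀ : SpaceTimeIdx L M, imagTimeWeight β M *
      ∑ x ∈ (univ : Finset (Fin 2 → SpaceTimeIdx L M)).filter (fun x => x 0 = x₀),
        (1 + ((((x 1).2 - (x 0).2) 0).valMinAbs.natAbs : ℝ) + ((((x 1).2 - (x 0).2) 1).valMinAbs.natAbs : ℝ)) ^ r *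
          ‖sectorisedKernel L M β (trivialMultiplier L M)
              (effAction ℂ (normalCovariance L M s₀ + ((t : ℂ)) • (normalCovariance L M s₁ - normalCovariance L M s₀))
                (hubbardInteraction L M β U)) 2
              (![((0, σ), 0), ((0, σ), 1)] : Fin 2 → SectorLeg 1) x‖ ≤ Sp)
    {N' : ℕ} {B : ℝ} (hB1 : 1 ≤ B) (hB : ∀ l ≤ N', ∀ t, ‖iteratedDeriv l salmhoferCutoff t‖ ≤ B) (hN' : r + 4 ≤ N')
    {G : GeoConsts} {Q : EngConsts} {R : RenConsts} (hGS : ∀ k, 0 ≤ G.S k) (hQS : ∀ k, 0 ≤ Q.S' k) (hRG : ∀ j, 0 ≤ R.Gfr j)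
    (hP : ∀ m ≤ n, FlowPieceJetsAt L M β U μ R m) (hT : ∀ m ≤ n, TwoLegReadJetsF L M G Q β U μ m)
    {X₁ : ℝ} (hlo : (4 : ℝ) ^ n ≤ 6 / max |matsubaraFreq β M i| (Λ / 2)) (hhi : 6 / max |matsubaraFreq β M i| (Λ / 2) ≤ X₁ * (4 : ℝ) ^ n)
    {A : ℕ → ℝ} (hA : ∀ j, A j = if j ≤ 4 then R.Gfr j * uPow j U
      else 2 ^ j * (Real.pi ^ 8 / 4 * 2 ^ (j - 1) * (2 : ℝ) ^ (8 * (j - 1))) * ((curveExtC B G.S 1 + curveExtC B Q.S' 1 * |U|) * U ^ 2))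
    {d : ℝ} (hd : d = 4 + 2 * ∑ j' ∈ range (r + 3), A j')
    {J : ℝ} (hJ : J = (2 * (β * (L : ℝ) ^ 2) * B * X₁ ^ 2 / 9) * (∑ k' ∈ Finset.range (r + 3), (Real.pi / 2) ^ k' *
      ∑ j ∈ Finset.range (k' + 1), (k'.choose j : ℝ) * ((j ! : ℝ) * j !) * (max d 1 * X₁) ^ j * A (k' - j)) * (4 : ℝ) ^ ((r + 2) * n)) :
    ∑ x : TorusSite 2 L, (1 + ((x 0).valMinAbs.natAbs : ℝ) + ((x 1).valMinAbs.natAbs : ℝ)) ^ r * ‖torusFourierInv (fun kv : TorusSite 2 L =>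
        selfEnergy L M β (effAction ℂ (normalCovariance L M s₁) (hubbardInteraction L M β U)) (i, kv) σ -
          selfEnergy L M β (effAction ℂ (normalCovariance L M s₀) (hubbardInteraction L M β U)) (i, kv) σ) x‖ ≤
      2 * (|β| * (L : ℝ) ^ 2) *
        (12 * (2 * (L : ℝ) ^ 2 * ((2 * B + 1) * (β * (L : ℝ) ^ 2)) * (2 * β / Λ) *
            frameDist (klFlowFrameU L M β U μ (n + 1)) (klFlowFrameU L M β U μ n)) * (Np / (β * (L : ℝ) ^ 2) ^ 3) +
          2 * (21 * 3 ^ r * J) * (Sp / (β * (L : ℝ) ^ 2)) ^ 2) := by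
  have hB0 : 0 ≤ B := zero_le_one.trans hB1
  have hB' : ∀ y, |deriv salmhoferCutoff y| ≤ B := abs_deriv_salmhoferCutoff_le_of_table hB (by omega)
  have hX : ∀ l ≤ 4, ∀ x : ℝ, ‖iteratedFDeriv ℝ l salmhoferCutoff x‖ ≤ B := norm_iteratedFDeriv_salmhoferCutoff_le_of_table hB (by omega)
  have hmω : 0 < max |matsubaraFreq β M i| (Λ / 2) := lt_max_of_lt_right (by positivity)
  have hA0 : ∀ j, 0 ≤ A j := fun j => by rw [hA j]; exact flowPiece_tableA_nonneg hRG hGS hQS hB0 U j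
  -- the geometric piece table
  have htab := flowPiece_jets_geometric (L := L) (M := M) hGS hQS hμ hX hP hT
  have hpj : ∀ m ≤ n, ∀ j ≤ r + 2, ∀ q : Momentum,
      ‖iteratedFDeriv ℝ j (evalM (klFlowPiece L M β U μ m)) q‖ ≤ A j * (4 : ℝ) ^ (((j : ℤ) - 2) * m) := by
    intro m hm j hj q
    rw [hA j]
    exact htab m hm j (by omega) q
  have hpjA : ∀ m ≤ n, ∀ j ≤ r + 2, A j * (4 : ℝ) ^ (((j : ℤ) - 2) * m) ≤ A j * (4 : ℝ) ^ (((j : ℤ) - 2) * m) := fun _ _ _ _ => le_rfl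
  -- the fit and the table
  have hfit := flowStep_fit_of_geometric_tables (pj := fun m j => A j * (4 : ℝ) ^ (((j : ℤ) - 2) * m)) hA0 hpjA hlo
  have htable := flowStep_table_of_geometric_tables (pj := fun m j => A j * (4 : ℝ) ^ (((j : ℤ) - 2) * m)) (n := n) hA0
    (fun k hk => hpjA n le_rfl k hk) (V := β * (L : ℝ) ^ 2) (B := B) (d := d) (by positivity) hB0 hmω hhi
  rw [← hd] at hfit
  rw [← hJ] at htable
  exact moment_selfEnergy_flowStep_sub_le_of_position hB' hβ hΛ μ U n hs₀ hs₁ i σ r hZ hNp hSp hB1 hB hN' hpj hfit htable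

/-- **DOOR (B) READ ON THE FLOW FRAMES, KEYED TO THE HISTORY**: the momentum jets of order `j ≤ 4` of the interpolated, spin/frequency-averaged real part of
the two-leg response between `K_n` and `K_{n+1}`; the scale window is asked at the two reading indices `ip`, `im`. -/
theorem norm_iteratedFDeriv_evalM_symInterp_flowStep_response_le_of_hist {β : ℝ} (hβ : 0 < β) {Λ : ℝ} (hΛ : 0 < Λ) {μ : ℝ}
    (hμ : μ ∈ klWindowC) (U : ℝ) (n : ℕ) {s₀ s₁ : FreqMomentum L M × Fin 2 → ℂ} (hs₀ : s₀ = uvSymbolCT L M β μ (klFlowFrameU L M β U μ n) Λ)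
    (hs₁ : s₁ = uvSymbolCT L M β μ (klFlowFrameU L M β U μ (n + 1)) Λ) (ip im : MatsubaraIdx M) {j : ℕ} (hjr : j ≤ 4)
    (hZ : ∀ t ∈ Set.Icc (0 : ℝ) 1, effPartitionFn ℂ (normalCovariance L M s₀ + ((t : ℂ)) • (normalCovariance L M s₁ - normalCovariance L M s₀))
      (hubbardInteraction L M β U) ≠ 0)
    {Np Sp : ℝ}
    (hNp : ∀ (σ τ c : Fin 2), ∀ t ∈ Set.Icc (0 : ℝ) 1, ∀ x₀ : SpaceTimeIdx L M, imagTimeWeight β M ^ 3 *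
      ∑ x ∈ (univ : Finset (Fin 4 → SpaceTimeIdx L M)).filter (fun x => x 0 = x₀),
        (1 + ((((x 1).2 - (x 0).2) 0).valMinAbs.natAbs : ℝ) + ((((x 1).2 - (x 0).2) 1).valMinAbs.natAbs : ℝ)) ^ j *
          ‖sectorisedKernel L M β (trivialMultiplier L M)
              (effAction ℂ (normalCovariance L M s₀ + ((t : ℂ)) • (normalCovariance L M s₁ - normalCovariance L M s₀))
                (hubbardInteraction L M β U)) 4
              (![((0, σ), 0), ((0, σ), 1), ((0, τ), 1 - c), ((0, τ), c)] : Fin 4 → SectorLeg 1) x‖ ≤ Np)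
    (hSp : ∀ (σ : Fin 2), ∀ t ∈ Set.Icc (0 : ℝ) 1, ∀ x₀ : SpaceTimeIdx L M, imagTimeWeight β M *
      ∑ x ∈ (univ : Finset (Fin 2 → SpaceTimeIdx L M)).filter (fun x => x 0 = x₀),
        (1 + ((((x 1).2 - (x 0).2) 0).valMinAbs.natAbs : ℝ) + ((((x 1).2 - (x 0).2) 1).valMinAbs.natAbs : ℝ)) ^ j *
          ‖sectorisedKernel L M β (trivialMultiplier L M)
              (effAction ℂ (normalCovariance L M s₀ + ((t : ℂ)) • (normalCovariance L M s₁ - normalCovariance L M s₀))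
                (hubbardInteraction L M β U)) 2
              (![((0, σ), 0), ((0, σ), 1)] : Fin 2 → SectorLeg 1) x‖ ≤ Sp)
    {N' : ℕ} {B : ℝ} (hB1 : 1 ≤ B) (hB : ∀ l ≤ N', ∀ t, ‖iteratedDeriv l salmhoferCutoff t‖ ≤ B) (hN' : j + 4 ≤ N')
    {G : GeoConsts} {Q : EngConsts} {R : RenConsts} (hGS : ∀ k, 0 ≤ G.S k) (hQS : ∀ k, 0 ≤ Q.S' k) (hRG : ∀ j, 0 ≤ R.Gfr j)
    (hP : ∀ m ≤ n, FlowPieceJetsAt L M β U μ R m) (hT : ∀ m ≤ n, TwoLegReadJetsF L M G Q β U μ m)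
    {X₁ : ℝ} (hlo : ∀ i : MatsubaraIdx M, i = ip ∨ i = im → (4 : ℝ) ^ n ≤ 6 / max |matsubaraFreq β M i| (Λ / 2))
    (hhi : ∀ i : MatsubaraIdx M, i = ip ∨ i = im → 6 / max |matsubaraFreq β M i| (Λ / 2) ≤ X₁ * (4 : ℝ) ^ n)
    {A : ℕ → ℝ} (hA : ∀ j', A j' = if j' ≤ 4 then R.Gfr j' * uPow j' U
      else 2 ^ j' * (Real.pi ^ 8 / 4 * 2 ^ (j' - 1) * (2 : ℝ) ^ (8 * (j' - 1))) * ((curveExtC B G.S 1 + curveExtC B Q.S' 1 * |U|) * U ^ 2))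
    {d : ℝ} (hd : d = 4 + 2 * ∑ j' ∈ range (j + 3), A j')
    {J : ℝ} (hJ : J = (2 * (β * (L : ℝ) ^ 2) * B * X₁ ^ 2 / 9) * (∑ k' ∈ Finset.range (j + 3), (Real.pi / 2) ^ k' *
      ∑ j' ∈ Finset.range (k' + 1), (k'.choose j' : ℝ) * ((j' ! : ℝ) * j' !) * (max d 1 * X₁) ^ j' * A (k' - j')) * (4 : ℝ) ^ ((j + 2) * n))
    (q : Momentum) :
    ‖iteratedFDeriv ℝ j (evalM (symInterp L (fun kv : TorusSite 2 L => (∑ σ : Fin 2,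
        ((selfEnergy L M β (effAction ℂ (normalCovariance L M s₁) (hubbardInteraction L M β U)) (ip, kv) σ -
            selfEnergy L M β (effAction ℂ (normalCovariance L M s₀) (hubbardInteraction L M β U)) (ip, kv) σ).re +
          (selfEnergy L M β (effAction ℂ (normalCovariance L M s₁) (hubbardInteraction L M β U)) (im, kv) σ -
            selfEnergy L M β (effAction ℂ (normalCovariance L M s₀) (hubbardInteraction L M β U)) (im, kv) σ).re)) / 4))) q‖ ≤
      2 * (|β| * (L : ℝ) ^ 2) *
        (12 * (2 * (L : ℝ) ^ 2 * ((2 * B + 1) * (β * (L : ℝ) ^ 2)) * (2 * β / Λ) *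
            frameDist (klFlowFrameU L M β U μ (n + 1)) (klFlowFrameU L M β U μ n)) * (Np / (β * (L : ℝ) ^ 2) ^ 3) +
          2 * (21 * 3 ^ j * J) * (Sp / (β * (L : ℝ) ^ 2)) ^ 2) := by
  have hB0 : 0 ≤ B := zero_le_one.trans hB1
  have hB' : ∀ y, |deriv salmhoferCutoff y| ≤ B := abs_deriv_salmhoferCutoff_le_of_table hB (by omega)
  have hX : ∀ l ≤ 4, ∀ x : ℝ, ‖iteratedFDeriv ℝ l salmhoferCutoff x‖ ≤ B := norm_iteratedFDeriv_salmhoferCutoff_le_of_table hB (by omega)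
  have hA0 : ∀ j', 0 ≤ A j' := fun j' => by rw [hA j']; exact flowPiece_tableA_nonneg hRG hGS hQS hB0 U j'
  have htab := flowPiece_jets_geometric (L := L) (M := M) hGS hQS hμ hX hP hT
  have hpj : ∀ m ≤ n, ∀ j' ≤ j + 2, ∀ q : Momentum,
      ‖iteratedFDeriv ℝ j' (evalM (klFlowPiece L M β U μ m)) q‖ ≤ A j' * (4 : ℝ) ^ (((j' : ℤ) - 2) * m) := by
    intro m hm j' hj' q
    rw [hA j']
    exact htab m hm j' (by omega) q
  have hpjA : ∀ m ≤ n, ∀ j' ≤ j + 2, A j' * (4 : ℝ) ^ (((j' : ℤ) - 2) * m) ≤ A j' * (4 : ℝ) ^ (((j' : ℤ) - 2) * m) :=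
    fun _ _ _ _ => le_rfl
  have hfit : ∀ (i : MatsubaraIdx M), i = ip ∨ i = im → ∀ (j' : ℕ), 1 ≤ j' → j' ≤ j + 2 →
      4 + ∑ m ∈ range n, A j' * (4 : ℝ) ^ (((j' : ℤ) - 2) * m) + A j' * (4 : ℝ) ^ (((j' : ℤ) - 2) * n) ≤
        d * (6 / max |matsubaraFreq β M i| (Λ / 2)) ^ (j' - 1) := by
    intro i hi
    rw [hd]
    exact flowStep_fit_of_geometric_tables (pj := fun m j' => A j' * (4 : ℝ) ^ (((j' : ℤ) - 2) * m)) hA0 hpjA (hlo i hi)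
  have htable : ∀ (i : MatsubaraIdx M), i = ip ∨ i = im → ∀ k ≤ j + 2, (Real.pi / 2) ^ k *
      ∑ j' ∈ Finset.range (k + 1), (k.choose j' : ℝ) *
        (j' ! * ((2 * (β * (L : ℝ) ^ 2) * B * (2 / max |matsubaraFreq β M i| (Λ / 2)) ^ 2) * j' !) *
          (max d 1 * (6 / max |matsubaraFreq β M i| (Λ / 2))) ^ j') * (A (k - j') * (4 : ℝ) ^ ((((k - j' : ℕ) : ℤ) - 2) * n)) ≤ J := by
    intro i hi
    have hmω : 0 < max |matsubaraFreq β M i| (Λ / 2) := lt_max_of_lt_right (by positivity)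
    rw [hJ]
    exact flowStep_table_of_geometric_tables (pj := fun m j' => A j' * (4 : ℝ) ^ (((j' : ℤ) - 2) * m)) (n := n) hA0
      (fun k hk => hpjA n le_rfl k hk) (V := β * (L : ℝ) ^ 2) (B := B) (d := d) (by positivity) hB0 hmω (hhi i hi)
  exact norm_iteratedFDeriv_evalM_symInterp_flowStep_response_le_of_position hB' hβ hΛ μ U n hs₀ hs₁ ip im j hZ hNp hSp hB1 hB hN'
    hpj hfit htable q

end Summit.HubbardSuperconductivity.HubbardSuperconductivity.Theorems.EngineV8

end
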